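import Summits.BirchSwinnertonDyer.BirchSwinnertonDyer.Theorems.EisensteinDepletionAtTwoStarPrimeLevelSeventeen
import Literature.NumberTheory.EllipticCurves.ConductorSeventeenCurves
import HarnessLib

/-!
# Route `EisensteinDepletionAtTwo`, crux E1M `DepletedLambdaLawAtTwoMod` (item stmt-BirchSwinnertonDyer-20341),
# line `star` — `StarNoPrimeHabitat` from the two NAMED classifications (by name)

Cell `bsd-rank2`, seat `bsd-rank2-eng-2` GEN 9. THEOREMS ONLY; no `sorry`. HONEST FRAMING: a 3-line corollary; nothing reads an
analytic rank; (★-SymbC)/(★)/E1M are NOT proved; BSD is not proved by any of this (PARTITION D-0054: none — r_an ≥ 2 axis S0).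

`starNoPrimeHabitat_of_setzer_of_cremona`: the body of the registered stub `stub_starNoPrimeHabitat` (skeleton v3.3/v3.4 of
`Cruxes/DepletedLambdaLawAtTwoMod/Lines/star.lean`) from the two tree NAMED FACTS
`Setzer1975_primeConductor_rationalTwoTorsion` (lit GEN 21, `NeumannSetzerCurves.lean`) and
`Cremona1997_conductor_seventeen_classification` (`ConductorSeventeenCurves.lean`) — i.e. `starNoPrimeHabitat_of_facts`
(`…StarPrimeLevelSeventeen.lean`) with its table hypothesis `h17` instantiated by name (the models `cremona17a1..a4` unfold to the
coefficient vectors). So the stub is closed modulo exactly two published classifications, both displayed by name.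

APPENDED (same GEN): `not_prop514_of_smul_eq_cremona17` (the case analysis with the isomorphism `C • W = 17aᵢ` as hypothesis on `W`
alone), `not_prop514_of_conductor_seventeen_of_twoTorsionList` and `starNoPrimeHabitat_of_setzer_of_twoTorsionList` (the
`2`-torsion-RESTRICTED conductor-`17` list — the `p = 17` case of Setzer's own theorem, lit GEN 23's discharge programme — suffices).

References: B. Setzer, J. London Math. Soc. (2) 10 (1975) [Setzer1975]; J. E. Cremona, *Algorithms for Modular Elliptic Curves*
(1997), Table 1 [CremonaAlgorithms1997]; R. Greenberg, LNM 1716 (1999), Prop. 5.14 [GreenbergLNM1716].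
-/

set_option linter.dupNamespace false
set_option autoImplicit false

noncomputable section

open scoped Classical

open WeierstrassCurve Literature.NumberTheory.EllipticCurves Literature.NumberTheory.EllipticCurves.Greenberg1999
  Literature.NumberTheory.EllipticCurves.Rank1Residual.X11RankOneCertificates

namespace Summit.BirchSwinnertonDyer.BirchSwinnertonDyer.Theorems.DepletionAtTwo

/-- **No Prop-5.14 point at conductor `17`**, from the NAMED table fact `Cremona1997_conductor_seventeen_classification`.
[cite: CremonaAlgorithms1997, Table 1 (N = 17)] [cite: GreenbergLNM1716, Prop. 5.14 (chunk p0170)] -/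
theorem not_prop514_of_conductor_seventeen_of_cremona (h17 : Cremona1997_conductor_seventeen_classification)
    (W : WeierstrassCurve ℚ) [W.IsElliptic] [W.IsGloballyMinimal] (hN : W.conductorNorm ℤ = 17) {x : ℚ}
    (hx : HasUniqueRationalTwoTorsionX W x) :
    ¬ ((TwoTorsionRamifiedAtTwo x ∧ ¬ TwoTorsionOdd W x) ∨ (TwoTorsionOdd W x ∧ ¬ TwoTorsionRamifiedAtTwo x)) :=
  not_prop514_of_conductor_seventeen (fun V _ hV ↦ h17 V hV) W hN hx

/-- **`StarNoPrimeHabitat` from the two named classifications** (Setzer 1975; Cremona's Table 1 at `N = 17`): no curve of the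
Prop-5.14 habitat (globally minimal, good ordinary at `2`, a UNIQUE rational `2`-torsion point of type A xor B) has prime conductor —
the body of the registered stub, verbatim. [cite: Setzer1975, pp. 367–378 (main theorem)] [cite: CremonaAlgorithms1997, Table 1 (N = 17)]
[cite: GreenbergLNM1716, Prop. 5.14 (chunk p0170)] -/
theorem starNoPrimeHabitat_of_setzer_of_cremona (hS : Setzer1975_primeConductor_rationalTwoTorsion)
    (h17 : Cremona1997_conductor_seventeen_classification) :
    ∀ (W : WeierstrassCurve ℚ) [W.IsElliptic] [W.IsGloballyMinimal] (x : ℚ), IsOrdinaryAt W 2 →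
      HasUniqueRationalTwoTorsionX W x →
      ((TwoTorsionRamifiedAtTwo x ∧ ¬ TwoTorsionOdd W x) ∨ (TwoTorsionOdd W x ∧ ¬ TwoTorsionRamifiedAtTwo x)) →
      ¬ (W.conductorNorm ℤ).Prime :=
  starNoPrimeHabitat_of_facts hS (fun V _ hV ↦ h17 V hV)


/-! ## The core case analysis with the model as a HYPOTHESIS on `W` alone (so that a `2`-torsion-restricted conductor-`17` list —
the shape Setzer's own case `p = 17` delivers, cf. lit GEN 23's discharge programme (S3) — suffices) -/

section Core

variable (W : WeierstrassCurve ℚ) [W.IsElliptic] [W.IsGloballyMinimal]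

/-- **No Prop-5.14 point on a globally minimal curve `ℚ`-isomorphic to one of 17a1–17a4** (the case analysis of
`not_prop514_of_conductor_seventeen` with the isomorphism as the hypothesis, no table quantified over other curves): 17a1/17a3
ramified ∧ odd, 17a4 neither, 17a2 without a unique rational `2`-torsion point.
[cite: CremonaAlgorithms1997, Table 1 (N = 17)] [cite: GreenbergLNM1716, Prop. 5.14 (chunk p0170)] -/
theorem not_prop514_of_smul_eq_cremona17 (C : VariableChange ℚ)
    (hC : C • W = (⟨1, -1, 1, -1, -14⟩ : WeierstrassCurve ℚ) ∨ C • W = (⟨1, -1, 1, -6, -4⟩ : WeierstrassCurve ℚ) ∨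
      C • W = (⟨1, -1, 1, -91, -310⟩ : WeierstrassCurve ℚ) ∨ C • W = (⟨1, -1, 1, -1, 0⟩ : WeierstrassCurve ℚ))
    {x : ℚ} (hx : HasUniqueRationalTwoTorsionX W x) :
    ¬ ((TwoTorsionRamifiedAtTwo x ∧ ¬ TwoTorsionOdd W x) ∨ (TwoTorsionOdd W x ∧ ¬ TwoTorsionRamifiedAtTwo x)) := by
  -- the four integer models are global minimal models (`17⁴ ∤ c₄ = 33, 273, 4353, 33` or `q¹² ∤ Δ = ∓17^k`, `k ≤ 4`)
  have hmin : (C • W).IsGloballyMinimal := by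
    rcases hC with h | h | h | h <;> rw [h]
    · rw [show (⟨1, -1, 1, -1, -14⟩ : WeierstrassCurve ℚ) =
          ⟨((1 : ℤ) : ℚ), ((-1 : ℤ) : ℚ), ((1 : ℤ) : ℚ), ((-1 : ℤ) : ℚ), ((-14 : ℤ) : ℚ)⟩ by simp]
      refine isGloballyMinimal_of_int_criterion 1 (-1) 1 (-1) (-14) fun q hq hboth ↦ ?_
      obtain ⟨h12, -⟩ := hboth
      have hΔ : discOf [1, -1, 1, -1, -14] = -(17 : ℤ) ^ 4 := by simp only [discOf, invariants]; norm_num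
      rw [hΔ, dvd_neg] at h12
      have hq17 : (q : ℤ) ∣ 17 ^ 4 := dvd_trans (dvd_pow_self _ (by norm_num)) h12
      have hq17' : q ∣ 17 := (Nat.Prime.dvd_of_dvd_pow hq (by exact_mod_cast hq17))
      have : q = 17 := (Nat.prime_dvd_prime_iff_eq hq (by norm_num)).mp hq17'
      subst this
      have h' : (17 : ℤ) ^ 12 ∣ 17 ^ 4 := h12
      have h'' : 17 ^ 12 ∣ 17 ^ 4 := by exact_mod_cast h'
      exact absurd ((Nat.pow_dvd_pow_iff_le_right (by norm_num)).mp h'') (by norm_num)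
    · rw [show (⟨1, -1, 1, -6, -4⟩ : WeierstrassCurve ℚ) =
          ⟨((1 : ℤ) : ℚ), ((-1 : ℤ) : ℚ), ((1 : ℤ) : ℚ), ((-6 : ℤ) : ℚ), ((-4 : ℤ) : ℚ)⟩ by simp]
      refine isGloballyMinimal_of_int_criterion 1 (-1) 1 (-6) (-4) fun q hq hboth ↦ ?_
      obtain ⟨h12, -⟩ := hboth
      have hΔ : discOf [1, -1, 1, -6, -4] = (17 : ℤ) ^ 2 := by simp only [discOf, invariants]; norm_num
      rw [hΔ] at h12
      exact not_pow_twelve_dvd_sq_of_prime (by norm_num : (17 : ℕ).Prime) q hq (by exact_mod_cast h12)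
    · rw [show (⟨1, -1, 1, -91, -310⟩ : WeierstrassCurve ℚ) =
          ⟨((1 : ℤ) : ℚ), ((-1 : ℤ) : ℚ), ((1 : ℤ) : ℚ), ((-91 : ℤ) : ℚ), ((-310 : ℤ) : ℚ)⟩ by simp]
      refine isGloballyMinimal_of_int_criterion 1 (-1) 1 (-91) (-310) fun q hq hboth ↦ ?_
      obtain ⟨h12, -⟩ := hboth
      have hΔ : discOf [1, -1, 1, -91, -310] = (17 : ℤ) := by simp only [discOf, invariants]; norm_num
      rw [hΔ] at h12
      exact not_pow_twelve_dvd_sq_of_prime (by norm_num : (17 : ℕ).Prime) q hq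
        (dvd_trans h12 (dvd_pow_self _ (by norm_num)))
    · rw [show (⟨1, -1, 1, -1, 0⟩ : WeierstrassCurve ℚ) =
          ⟨((1 : ℤ) : ℚ), ((-1 : ℤ) : ℚ), ((1 : ℤ) : ℚ), ((-1 : ℤ) : ℚ), ((0 : ℤ) : ℚ)⟩ by simp]
      refine isGloballyMinimal_of_int_criterion 1 (-1) 1 (-1) 0 fun q hq hboth ↦ ?_
      obtain ⟨h12, -⟩ := hboth
      have hΔ : discOf [1, -1, 1, -1, 0] = (17 : ℤ) := by simp only [discOf, invariants]; norm_num
      rw [hΔ] at h12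
      exact not_pow_twelve_dvd_sq_of_prime (by norm_num : (17 : ℕ).Prime) q hq
        (dvd_trans h12 (dvd_pow_self _ (by norm_num)))
  haveI := hmin
  obtain ⟨hu2, r, hr⟩ := sq_u_eq_one_and_r_int W C
  have hx' : HasRationalTwoTorsionX (C • W) (C.toX x) := hasRationalTwoTorsionX_smul W C hx.1
  have hxeq : x = C.toX x + r := by
    have h := eq_ofX_toX C x
    rw [hu2, one_mul, hr] at h
    exact h
  rcases hC with h | h | h | h
  · -- 17a1: `x' = 11/4`, ramified and odd
    rw [h] at hx'
    obtain ⟨y, hE, h2⟩ := hx'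
    have hroot := root_seventeenA1 (fourXCubed_add_eq_zero_of_twoTorsion_real hE h2)
    have hx11 : C.toX x = 11 / 4 := by
      have h' : ((C.toX x : ℚ) : ℝ) = ((11 / 4 : ℚ) : ℝ) := by rw [hroot]; push_cast; ring
      exact_mod_cast h'
    have hram : TwoTorsionRamifiedAtTwo x := by
      rw [hxeq, hx11, show (11 / 4 : ℚ) = ((11 : ℤ) : ℚ) / 4 by norm_num]
      exact twoTorsionRamifiedAtTwo_quarter_add_int (by decide) r
    have hodd : TwoTorsionOdd W x := by
      refine (twoTorsionOdd_smul_iff W C x).mp ?_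
      rw [h, hx11]
      intro ρ hρ
      rw [root_seventeenA1 hρ]; push_cast; exact le_rfl
    rintro (⟨-, hnodd⟩ | ⟨-, hnram⟩)
    · exact hnodd hodd
    · exact hnram hram
  · -- 17a2: two distinct rational `2`-torsion points
    exact (false_of_unique_of_two W C hx (h ▸ hasRationalTwoTorsionX_seventeenA2.1)
      (h ▸ hasRationalTwoTorsionX_seventeenA2.2) (by norm_num)).elim
  · -- 17a3: `x' = −21/4`, ramified and odd
    rw [h] at hx'
    obtain ⟨y, hE, h2⟩ := hx'
    have hroot := root_seventeenA3 (fourXCubed_add_eq_zero_of_twoTorsion_real hE h2)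
    have hx21 : C.toX x = -21 / 4 := by
      rcases hroot with h1 | h1
      · have h' : ((C.toX x : ℚ) : ℝ) = ((-21 / 4 : ℚ) : ℝ) := by rw [h1]; push_cast; ring
        exact_mod_cast h'
      · exfalso
        have h68 : ((C.toX x : ℝ) - 3) ^ 2 = 68 := h1
        have hq : ((C.toX x - 3 : ℚ) : ℝ) ^ 2 = ((68 : ℚ) : ℝ) := by push_cast; linear_combination h68
        have hq' : (C.toX x - 3 : ℚ) ^ 2 = 68 := by exact_mod_cast hq
        -- `68 = 4·17` is not a rational square
        have : ((C.toX x - 3) / 2 : ℚ) ^ 2 = ((17 : ℕ) : ℚ) := by push_cast; linear_combination hq' / 4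
        exact not_sq_eq_prime (by norm_num : (17 : ℕ).Prime) _ this
    have hram : TwoTorsionRamifiedAtTwo x := by
      rw [hxeq, hx21, show (-21 / 4 : ℚ) = ((-21 : ℤ) : ℚ) / 4 by norm_num]
      exact twoTorsionRamifiedAtTwo_quarter_add_int (by decide) r
    have hodd : TwoTorsionOdd W x := by
      refine (twoTorsionOdd_smul_iff W C x).mp ?_
      rw [h, hx21]
      intro ρ hρ
      push_cast
      rcases root_seventeenA3 hρ with h1 | h1
      · rw [h1]
      · -- `|ρ − 3| = √68 < 33/4`, so `ρ ≥ 3 − 33/4 = −21/4`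
        nlinarith [sq_nonneg (ρ - 3 + 33 / 4), sq_nonneg (ρ - 3 - 33 / 4)]
    rintro (⟨-, hnodd⟩ | ⟨-, hnram⟩)
    · exact hnodd hodd
    · exact hnram hram
  · -- 17a4: `x' = 1`, neither ramified nor odd
    rw [h] at hx'
    obtain ⟨y, hE, h2⟩ := hx'
    have hroot := root_seventeenA4 (fourXCubed_add_eq_zero_of_twoTorsion_real hE h2)
    have hx1 : C.toX x = 1 := by
      rcases hroot with h1 | h1
      · have h' : ((C.toX x : ℚ) : ℝ) = ((1 : ℚ) : ℝ) := by rw [h1]; push_cast; ring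
        exact_mod_cast h'
      · exfalso
        have hq : ((8 * C.toX x + 1 : ℚ) : ℝ) ^ 2 = ((17 : ℕ) : ℝ) := by push_cast; linear_combination h1
        have hq' : (8 * C.toX x + 1 : ℚ) ^ 2 = ((17 : ℕ) : ℚ) := by exact_mod_cast hq
        exact not_sq_eq_prime (by norm_num : (17 : ℕ).Prime) _ hq'
    have hnram : ¬ TwoTorsionRamifiedAtTwo x := by
      rw [hxeq, hx1, show (1 : ℚ) + (r : ℚ) = ((1 + r : ℤ) : ℚ) by push_cast; ring]
      exact Summit.BirchSwinnertonDyer.Rank1Residual.X5.Instances.not_twoTorsionRamifiedAtTwo_intCast _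
    have hnodd : ¬ TwoTorsionOdd W x := by
      intro hodd
      have h' := (twoTorsionOdd_smul_iff W C x).mpr hodd
      rw [h, hx1] at h'
      -- the root `(−1 − √17)/8 < 1`
      set s : ℝ := Real.sqrt 17 with hs
      have hs2 : s ^ 2 = 17 := by rw [hs, Real.sq_sqrt (by norm_num)]
      have hs0 : 0 ≤ s := Real.sqrt_nonneg _
      have hroot' : 4 * ((-1 - s) / 8) ^ 3 + ((⟨1, -1, 1, -1, 0⟩ : WeierstrassCurve ℚ).b₂ : ℝ) * ((-1 - s) / 8) ^ 2 +
          2 * ((⟨1, -1, 1, -1, 0⟩ : WeierstrassCurve ℚ).b₄ : ℝ) * ((-1 - s) / 8) +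
          ((⟨1, -1, 1, -1, 0⟩ : WeierstrassCurve ℚ).b₆ : ℝ) = 0 := by
        simp only [WeierstrassCurve.b₂, WeierstrassCurve.b₄, WeierstrassCurve.b₆]
        push_cast
        linear_combination ((-9 - s) / 128) * hs2
      have hle := h' _ hroot'
      push_cast at hle
      linarith
    rintro (⟨hram, -⟩ | ⟨hodd, -⟩)
    · exact hnram hram
    · exact hnodd hodd

/-- **The `2`-torsion-restricted conductor-`17` list suffices**: if every elliptic curve over `ℚ` of conductor `17` WITH a rational
point of order `2` is `ℚ`-isomorphic to one of 17a1–17a4 (the `p = 17` case of Setzer's classification, binder order of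
`Setzer1975_primeConductor_rationalTwoTorsion`), then no Prop-5.14 point exists at conductor `17`.
[cite: Setzer1975, pp. 367–378 (main theorem, case p = 17)] [cite: CremonaAlgorithms1997, Table 1 (N = 17)] -/
theorem not_prop514_of_conductor_seventeen_of_twoTorsionList
    (h17 : ∀ (V : WeierstrassCurve ℚ) [V.IsElliptic] (z : ℚ), HasRationalTwoTorsionX V z → V.conductorNorm ℤ = 17 →
      ∃ C : WeierstrassCurve.VariableChange ℚ,
        C • V = (⟨1, -1, 1, -1, -14⟩ : WeierstrassCurve ℚ) ∨ C • V = (⟨1, -1, 1, -6, -4⟩ : WeierstrassCurve ℚ) ∨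
          C • V = (⟨1, -1, 1, -91, -310⟩ : WeierstrassCurve ℚ) ∨ C • V = (⟨1, -1, 1, -1, 0⟩ : WeierstrassCurve ℚ))
    (hN : W.conductorNorm ℤ = 17) {x : ℚ} (hx : HasUniqueRationalTwoTorsionX W x) :
    ¬ ((TwoTorsionRamifiedAtTwo x ∧ ¬ TwoTorsionOdd W x) ∨ (TwoTorsionOdd W x ∧ ¬ TwoTorsionRamifiedAtTwo x)) := by
  obtain ⟨C, hC⟩ := h17 W x hx.1 hN
  exact not_prop514_of_smul_eq_cremona17 W C hC hx

end Core

/-- **`StarNoPrimeHabitat` from Setzer's classification together with its `p = 17` list** (both in the binder order of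
`Setzer1975_primeConductor_rationalTwoTorsion`; the second becomes a theorem the day the first is discharged with its case
`p = 17` made explicit — lit GEN 23's programme): the body of the registered stub, verbatim.
[cite: Setzer1975, pp. 367–378 (main theorem)] [cite: GreenbergLNM1716, Prop. 5.14 (chunk p0170)] -/
theorem starNoPrimeHabitat_of_setzer_of_twoTorsionList (hS : Setzer1975_primeConductor_rationalTwoTorsion)
    (h17 : ∀ (V : WeierstrassCurve ℚ) [V.IsElliptic] (z : ℚ), HasRationalTwoTorsionX V z → V.conductorNorm ℤ = 17 →
      ∃ C : WeierstrassCurve.VariableChange ℚ,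
        C • V = (⟨1, -1, 1, -1, -14⟩ : WeierstrassCurve ℚ) ∨ C • V = (⟨1, -1, 1, -6, -4⟩ : WeierstrassCurve ℚ) ∨
          C • V = (⟨1, -1, 1, -91, -310⟩ : WeierstrassCurve ℚ) ∨ C • V = (⟨1, -1, 1, -1, 0⟩ : WeierstrassCurve ℚ)) :
    ∀ (W : WeierstrassCurve ℚ) [W.IsElliptic] [W.IsGloballyMinimal] (x : ℚ), IsOrdinaryAt W 2 →
      HasUniqueRationalTwoTorsionX W x →
      ((TwoTorsionRamifiedAtTwo x ∧ ¬ TwoTorsionOdd W x) ∨ (TwoTorsionOdd W x ∧ ¬ TwoTorsionRamifiedAtTwo x)) →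
      ¬ (W.conductorNorm ℤ).Prime := by
  intro W _ _ x _ hx hAB hN
  by_cases h : W.conductorNorm ℤ = 17
  · exact not_prop514_of_conductor_seventeen_of_twoTorsionList W h17 h hx hAB
  · exact not_prop514_of_prime_conductor W hS hN h hx.1 hAB

end Summit.BirchSwinnertonDyer.BirchSwinnertonDyer.Theorems.DepletionAtTwo

end
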